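import Summits.CriticalPhenomena.CardyFormulaZ2.Theorems.CardyComplexConeEdgePrecompactVertexRelationOnceTwice

/-!
# Return law, file 1: the once/twice pair of exploration paths at a toggled edge — visit structure
(line `flip-involution-return-law` of crux `CardyComplexCone.ParafermionToSLESixFamilies`, stmt-CriticalPhenomena-11389;
first helper file of the stub `stub_returnLaw`, the flip-involution RETURN LAW)

The return law (RL) compares, for a bond configuration `ω` and its flip `ω △ {e}` at an interior edge
`e = cTgt d`, the visits of the medial exploration path to the medial vertex `e`. The combinatorial heart
is the ONCE/TWICE pair of Smirnov's table (Ann. of Math. 172 (2010), proof of Lemma 4.5; at `q = 1`: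
Duminil-Copin–Smirnov, arXiv:1109.1549, Prop. 8.6): two completed configurations agreeing off `e` and
differing at `e`; in the ONCE-configuration `ω₁` (exit time `N₁`) the corner `d = orb i₁` arrives at `e`
and turns by `σ = turnSign d`, its partner `d₂` (the other corner arriving at `e`) is not a dart; in the
TWICE-configuration `ω₂` the path arrives along `d` with the same prefix, turns by `−σ`, runs once around
the cycle `L` of `d₂` (minimal period `Q`, ASSUMED to turn by `4σ` — the planar input, true for Jordan
data: `spliceLoop_turning_eq`), arrives again along `d₂` with `C + 2σ` quarter turns accumulated
(`C = turnCount i₁`), and turns by `−σ` again.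

This file isolates, as ONE registered sub-goal `onceTwice_visits`, exactly the data the return law
consumes (the tree's `vertexRelation_onceTwice` exports only four phase sums): the exit time
`N₂ = N₁ + Q`, the arrival times at `e` (`{i₁}` on the once-path, `{i₁, i₁ + Q}` on the twice-path),
the turn counts on arrival (`C`, `C`, `C + 2σ`) and the turn signs on departure (`σ`, `−σ`, `−σ`), and
`i₁ + 1 < N₁`. In words: the second arrival comes with winding `W₁ + σπ = W₁ − τ₁π` (`τ₁ = −σ` the first
turn of the twice-path) — antiparallel — and is followed by the forced turn `τ₂ = τ₁`.

Proof: adapted from `Theorems/CardyComplexConeEdgePrecompactVertexRelationOnceTwice.lean`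
(`vertexRelation_onceTwice`, crux EdgePrecompact), whose internal bookkeeping is reproduced and exported.
-/

namespace Summit.CriticalPhenomena.CardyFormulaZ2.Cruxes.ParafermionToSLESixFamilies.FlipInvolutionReturnLaw

open Literature.Probability.LatticeModels Literature.Probability.Percolation
open Summit.CriticalPhenomena.CardyFormulaZ2.Cruxes.EdgePrecompact.QkzStripBoundaryArm
  (nextCorner_ne_self exit_unique turnSign_partner turnSign_toggle)

/-- **Visit structure of a once/twice pair** (registered sub-goal `onceTwice_visits` of
stmt-CriticalPhenomena-11389, line `flip-involution-return-law`). Admissible data `E`, start corner `c₀`;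
two configurations whose completions agree off the edge `e = cTgt d` and differ at `e`, all faces at both
endpoints of `e` inner; in the ONCE-configuration `ω₁` (exit time `N₁`) the corner `d = orb i₁` is a dart
and its partner is not; `Q` is the minimal period of the partner's cycle under `ω₁`, assumed to turn by
`4 · turnSign d`; `N₂` is the exit time of `ω₂`. Then, with `σ = turnSign d` and `C = turnCount i₁`
(both in `ω₁`): `N₂ = N₁ + Q`; `i₁ + 1 < N₁`; on the once-path the arrivals at `e` (times `j < N₁` with
`orb j ∈ {d, partner d}`) are exactly `j = i₁`; on the twice-path exactly `j = i₁` (along `d`) and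
`j = i₁ + Q` (along the partner); the turn counts there are `C` (once), `C` and `C + 2σ` (twice), and the
turn signs `σ` (once), `−σ`, `−σ` (twice). -/
theorem onceTwice_visits : ∀ (E : DiscreteDobrushin), E.IsZdAdmissible → ∀ (ω₁ ω₂ : BondConfig (Site 2)) (c₀ d : Site 2 × Fin 4) (N₁ N₂ i₁ Q : ℕ), E.IsStartCorner c₀ → (∀ e', e' ≠ cTgt d → (e' ∈ E.bcBondConfig ω₂ ↔ e' ∈ E.bcBondConfig ω₁)) → ¬ (cTgt d ∈ E.bcBondConfig ω₂ ↔ cTgt d ∈ E.bcBondConfig ω₁) → (∀ j, E.IsInnerFace (faceAt d.1 j)) → (∀ j, E.IsInnerFace (faceAt (d.1 + cornerUnit (d.2 + 1)) j)) → ¬ E.IsInnerFace (cFace (cornerOrbit (E.bcBondConfig ω₁) c₀ N₁)) → (∀ k < N₁, E.IsInnerFace (cFace (cornerOrbit (E.bcBondConfig ω₁) c₀ k))) → ¬ E.IsInnerFace (cFace (cornerOrbit (E.bcBondConfig ω₂) c₀ N₂)) → (∀ k < N₂, E.IsInnerFace (cFace (cornerOrbit (E.bcBondConfig ω₂) c₀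 k))) → cornerOrbit (E.bcBondConfig ω₁) c₀ i₁ = d → i₁ < N₁ → (∀ i < N₁, cornerOrbit (E.bcBondConfig ω₁) c₀ i ≠ cornerPartner d) → 0 < Q → cornerOrbit (E.bcBondConfig ω₁) (cornerPartner d) Q = cornerPartner d → (∀ s, 0 < s → s < Q → cornerOrbit (E.bcBondConfig ω₁) (cornerPartner d) s ≠ cornerPartner d) → ∑ m ∈ Finset.range Q, turnSign (E.bcBondConfig ω₁) (cornerOrbit (E.bcBondConfig ω₁) (cornerPartner d) m) = 4 * turnSign (E.bcBondConfig ω₁) d → N₂ = N₁ + Q ∧ i₁ + 1 < N₁ ∧ (∀ j < N₁, (cornerOrbit (E.bcBondConfig ω₁) c₀ j = d ∨ cornerOrbit (E.bcBondConfig ω₁) c₀ j = cornerPartner d) ↔ j = i₁) ∧ (∀ j < N₂, (cornerOrbit (E.bcBondConfig ω₂) c₀ j = d ∨ cornerOrbit (E.bcBondConfig ω₂) c₀ j = cornerPartner d) ↔ (j = i₁ ∨ j = i₁ + Q)) ∧ cornerOrbit (E.bcBondConfig ω₂) c₀ i₁ = d ∧ cornerOrbit (E.bcBondConfig ω₂)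 c₀ (i₁ + Q) = cornerPartner d ∧ turnCount (E.bcBondConfig ω₂) c₀ i₁ = turnCount (E.bcBondConfig ω₁) c₀ i₁ ∧ turnCount (E.bcBondConfig ω₂) c₀ (i₁ + Q) = turnCount (E.bcBondConfig ω₁) c₀ i₁ + 2 * turnSign (E.bcBondConfig ω₁) d ∧ turnSign (E.bcBondConfig ω₂) d = -turnSign (E.bcBondConfig ω₁) d ∧ turnSign (E.bcBondConfig ω₂) (cornerPartner d) = -turnSign (E.bcBondConfig ω₁) d := by
  -- adapted from `vertexRelation_onceTwice` (Theorems/CardyComplexConeEdgePrecompactVertexRelationOnceTwice.lean)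
  intro E hE ω₁ ω₂ c₀ d N₁ N₂ i₁ Q hc₀ hagree hdiff hx hy hN₁ hlt₁ hN₂ hlt₂ hi₁ hi₁N h₂ hQ0 hQ hQmin hT
  classical
  have hstep : ∀ (β : BondConfig (Site 2)) (c : Site 2 × Fin 4) (i : ℕ),
      cornerOrbit β c (i + 1) = nextCorner β (cornerOrbit β c i) := fun _ _ _ => rfl
  -- the far endpoint `y` of `e` is interior, so `d` is not the last dart
  have hyB : (cornerPartner d).1 ∉ E.zdArcB := by
    intro h
    rcases E.zdArcB_subset_zdBoundary h with ⟨-, w, hvw, hnot⟩ | ⟨w, -, -, g, hg, hvg, -⟩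
    · obtain ⟨k, rfl⟩ := exists_eq_add_cornerUnit hvw
      exact hnot (DiscreteDobrushin.adj_of_isInnerFace_faceAt (hy k) (Or.inl rfl))
    · obtain ⟨k, rfl⟩ := exists_faceAt_of_isCorner hvg
      exact hg (hy k)
  have hi₁1 : i₁ + 1 < N₁ := by
    by_contra hcon
    have hN1 : N₁ = i₁ + 1 := by omega
    subst hN1
    obtain ⟨-, -, hB, -⟩ := cornerOrbit_exit hE hc₀ (n := i₁) (hlt₁ i₁ hi₁N) hN₁
    rw [hi₁] at hB
    exact hyB hB
  -- darts of the once-path are distinct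
  have hinj : ∀ a b, a < N₁ → b < N₁ → cornerOrbit (E.bcBondConfig ω₁) c₀ a = cornerOrbit (E.bcBondConfig ω₁) c₀ b → a = b := by
    intro a b ha hb h
    by_contra hne
    rcases Nat.lt_or_gt_of_ne hne with hab | hab
    · exact cornerOrbit_ne hE hc₀ hab (fun k hk => hlt₁ k (by omega)) h
    · exact cornerOrbit_ne hE hc₀ hab (fun k hk => hlt₁ k (by omega)) h.symm
  -- the interface orbit of `ω₁` is periodic; the partner's loop misses it entirely
  have hp₂in : E.IsInnerFace (cFace (cornerPartner d)) := hy _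
  have hc₀mesh : c₀.1 ∈ meshDomain E.Ω E.δ := fst_mem_meshDomain_of_isInnerFace (q := c₀) hc₀.isOutEdge.1
  have hexP : ∃ P, 0 < P ∧ cornerOrbit (E.bcBondConfig ω₁) c₀ P = c₀ := exists_cornerOrbit_period hE hc₀mesh
  have hP₀0 : 0 < Nat.find hexP := (Nat.find_spec hexP).1
  have hP₀ : cornerOrbit (E.bcBondConfig ω₁) c₀ (Nat.find hexP) = c₀ := (Nat.find_spec hexP).2
  have hP₀min : ∀ s, 0 < s → s < Nat.find hexP → cornerOrbit (E.bcBondConfig ω₁) c₀ s ≠ c₀ :=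
    fun s hs hsP h => Nat.find_min hexP hsP ⟨hs, h⟩
  have hdisj : ∀ m s, cornerOrbit (E.bcBondConfig ω₁) (cornerPartner d) m ≠ cornerOrbit (E.bcBondConfig ω₁) c₀ s := by
    intro m s h
    obtain ⟨s', hs'⟩ := exists_eq_cornerOrbit_of_iterate hP₀0 hP₀ m h
    have hin : E.IsInnerFace (cFace (cornerOrbit (E.bcBondConfig ω₁) c₀ s')) := hs' ▸ hp₂in
    rw [isInnerFace_cornerOrbit_iff hE hc₀ hN₁ hlt₁ hP₀0 hP₀ hP₀min] at hin
    exact h₂ _ hin (by rw [cornerOrbit_mod_period hP₀]; exact hs'.symm)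
  have hLinj : ∀ a b, a < Q → b < Q →
      cornerOrbit (E.bcBondConfig ω₁) (cornerPartner d) a = cornerOrbit (E.bcBondConfig ω₁) (cornerPartner d) b → a = b := by
    intro a b ha hb h
    by_contra hne
    rcases Nat.lt_or_gt_of_ne hne with hab | hab
    · obtain ⟨t, rfl⟩ := Nat.exists_eq_add_of_lt hab
      have := cornerOrbit_eq_of_add_eq (cornerPartner d) (i := 0) (j := t + 1) a
        (by rwa [zero_add, show t + 1 + a = a + t + 1 by omega])
      exact hQmin (t + 1) (Nat.succ_pos _) (by omega) this.symm
    · obtain ⟨t, rfl⟩ := Nat.exists_eq_add_of_lt hab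
      have := cornerOrbit_eq_of_add_eq (cornerPartner d) (i := 0) (j := t + 1) b
        (by rw [zero_add, show t + 1 + b = b + t + 1 by omega]; exact h.symm)
      exact hQmin (t + 1) (Nat.succ_pos _) (by omega) this.symm
  have hQ1 : 1 < Q := by
    by_contra h1
    have hQ1 : Q = 1 := by omega
    rw [hQ1] at hQ
    exact nextCorner_ne_self _ _ hQ
  -- the twice-path: prefix, loop, tail (case 1 of the rearrangement), exit at `N₁ + Q`
  obtain ⟨hpre, hloop, htail, hlt₂', hN₂'⟩ := cornerOrbit_toggle_case1 hE hc₀ hagree hdiff hx hy hN₁ hlt₁ hP₀0 hP₀ hP₀min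
    hQ0 hQ hQmin hi₁ hi₁N h₂
  obtain rfl : N₂ = N₁ + Q := exit_unique hN₂ hlt₂ hN₂' hlt₂'
  have horb₂ : ∀ j < N₁ + Q, (j ≤ i₁ ∧ cornerOrbit (E.bcBondConfig ω₂) c₀ j = cornerOrbit (E.bcBondConfig ω₁) c₀ j) ∨
      (∃ m, 0 < m ∧ m ≤ Q ∧ j = i₁ + m ∧ cornerOrbit (E.bcBondConfig ω₂) c₀ j = cornerOrbit (E.bcBondConfig ω₁) (cornerPartner d) m) ∨
      (∃ t, i₁ + 1 + t < N₁ ∧ j = i₁ + Q + 1 + t ∧ cornerOrbit (E.bcBondConfig ω₂) c₀ j = cornerOrbit (E.bcBondConfig ω₁) c₀ (i₁ + 1 + t)) := by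
    intro j hj
    by_cases h1 : j ≤ i₁
    · exact Or.inl ⟨h1, hpre j h1⟩
    · by_cases h2 : j ≤ i₁ + Q
      · refine Or.inr (Or.inl ⟨j - i₁, by omega, by omega, by omega, ?_⟩)
        have := hloop (j - i₁ - 1) (by omega)
        rwa [show i₁ + 1 + (j - i₁ - 1) = j by omega, show j - i₁ - 1 + 1 = j - i₁ by omega] at this
      · refine Or.inr (Or.inr ⟨j - i₁ - Q - 1, by omega, by omega, ?_⟩)
        have := htail (j - i₁ - Q - 1) (by omega)
        rwa [show i₁ + Q + 1 + (j - i₁ - Q - 1) = j by omega] at this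
  -- target edges other than those of `d`, `d₂` are not `e`
  have htgt₁ : ∀ j < N₁, j ≠ i₁ → cTgt (cornerOrbit (E.bcBondConfig ω₁) c₀ j) ≠ cTgt d := by
    intro j hj hji h
    rcases cTgt_eq_cTgt_iff.1 h with h | h
    · exact hji (hinj j i₁ hj hi₁N (h.trans hi₁.symm))
    · exact h₂ j hj h
  have htgtL : ∀ m, 0 < m → m < Q → cTgt (cornerOrbit (E.bcBondConfig ω₁) (cornerPartner d) m) ≠ cTgt d := by
    intro m hm hmQ h
    rcases cTgt_eq_cTgt_iff.1 h with h | h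
    · exact hdisj m i₁ (h.trans hi₁.symm)
    · exact hQmin m hm hmQ h
  -- turn signs and turn counts
  have hσ₂ : turnSign (E.bcBondConfig ω₂) d = -turnSign (E.bcBondConfig ω₁) d := turnSign_toggle hdiff
  have hσ₂' : turnSign (E.bcBondConfig ω₂) (cornerPartner d) = -turnSign (E.bcBondConfig ω₁) d := by
    rw [← turnSign_partner (E.bcBondConfig ω₁) d]
    exact turnSign_toggle (by rwa [cTgt_partner])
  have hC₁ : turnCount (E.bcBondConfig ω₂) c₀ i₁ = turnCount (E.bcBondConfig ω₁) c₀ i₁ :=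
    turnCount_congr_prefix (fun j hj => hpre j hj) (fun j hj => hagree _ (htgt₁ j (by omega) (by omega)))
  have hC₂a : turnCount (E.bcBondConfig ω₂) c₀ (i₁ + 1) = turnCount (E.bcBondConfig ω₁) c₀ i₁ - turnSign (E.bcBondConfig ω₁) d := by
    rw [turnCount_succ, hC₁, hpre i₁ le_rfl, hi₁, hσ₂]; ring
  have hC₂b : turnCount (E.bcBondConfig ω₂) c₀ (i₁ + Q) = turnCount (E.bcBondConfig ω₁) c₀ i₁ + 2 * turnSign (E.bcBondConfig ω₁) d := by
    have hadd := turnCount_add (E.bcBondConfig ω₂) c₀ (i₁ + 1) (Q - 1)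
    rw [show i₁ + 1 + (Q - 1) = i₁ + Q by omega] at hadd
    have hsum : ∑ m ∈ Finset.range (Q - 1), turnSign (E.bcBondConfig ω₂) (cornerOrbit (E.bcBondConfig ω₂) c₀ (i₁ + 1 + m)) =
        ∑ m ∈ Finset.range (Q - 1), turnSign (E.bcBondConfig ω₁) (cornerOrbit (E.bcBondConfig ω₁) (cornerPartner d) (m + 1)) := by
      refine Finset.sum_congr rfl fun m hm => ?_
      rw [Finset.mem_range] at hm
      rw [hloop m (by omega)]
      exact turnSign_congr (hagree _ (htgtL (m + 1) (Nat.succ_pos _) (by omega)))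
    have hT' : ∑ m ∈ Finset.range Q, turnSign (E.bcBondConfig ω₁) (cornerOrbit (E.bcBondConfig ω₁) (cornerPartner d) m) =
        ∑ m ∈ Finset.range (Q - 1), turnSign (E.bcBondConfig ω₁) (cornerOrbit (E.bcBondConfig ω₁) (cornerPartner d) (m + 1)) +
          turnSign (E.bcBondConfig ω₁) d := by
      conv_lhs => rw [show Q = Q - 1 + 1 by omega, Finset.sum_range_succ']
      rw [← turnSign_partner (E.bcBondConfig ω₁) d]
      rfl
    rw [hadd, hsum, hC₂a]
    rw [hT'] at hT
    linear_combination hT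
  have horbQ : cornerOrbit (E.bcBondConfig ω₂) c₀ (i₁ + Q) = cornerPartner d := by
    have := hloop (Q - 1) (by omega)
    rwa [show i₁ + 1 + (Q - 1) = i₁ + Q by omega, show Q - 1 + 1 = Q by omega, hQ] at this
  have horb₂i₁ : cornerOrbit (E.bcBondConfig ω₂) c₀ i₁ = d := (hpre i₁ le_rfl).trans hi₁
  -- uniqueness of the positions
  have huniq_d : ∀ j < N₁ + Q, cornerOrbit (E.bcBondConfig ω₂) c₀ j = d → j = i₁ := by
    intro j hj h
    rcases horb₂ j hj with ⟨hji, hj'⟩ | ⟨m, hm0, hmQ, rfl, hj'⟩ | ⟨t, ht, rfl, hj'⟩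
    · exact hinj j i₁ (by omega) hi₁N ((hj'.symm.trans h).trans hi₁.symm)
    · exact absurd ((hj'.symm.trans h).trans hi₁.symm) (hdisj m i₁)
    · have := hinj _ _ ht hi₁N ((hj'.symm.trans h).trans hi₁.symm); omega
  have huniq_d₂ : ∀ j < N₁ + Q, cornerOrbit (E.bcBondConfig ω₂) c₀ j = cornerPartner d → j = i₁ + Q := by
    intro j hj h
    rcases horb₂ j hj with ⟨hji, hj'⟩ | ⟨m, hm0, hmQ, rfl, hj'⟩ | ⟨t, ht, rfl, hj'⟩
    · exact absurd (hj'.symm.trans h) (h₂ j (by omega))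
    · rcases Nat.lt_or_ge m Q with hmQ' | hmQ'
      · exact absurd (hj'.symm.trans h) (hQmin m hm0 hmQ')
      · omega
    · exact absurd (hj'.symm.trans h) (h₂ _ ht)
  refine ⟨rfl, hi₁1, fun j hj => ⟨?_, ?_⟩, fun j hj => ⟨?_, ?_⟩, horb₂i₁, horbQ, hC₁, hC₂b, hσ₂, hσ₂'⟩
  · rintro (h | h)
    · exact hinj j i₁ hj hi₁N (h.trans hi₁.symm)
    · exact absurd h (h₂ j hj)
  · rintro rfl; exact Or.inl hi₁
  · rintro (h | h)
    · exact Or.inl (huniq_d j hj h)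
    · exact Or.inr (huniq_d₂ j hj h)
  · rintro (rfl | rfl)
    · exact Or.inl horb₂i₁
    · exact Or.inr horbQ

end Summit.CriticalPhenomena.CardyFormulaZ2.Cruxes.ParafermionToSLESixFamilies.FlipInvolutionReturnLaw
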